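import Summits.Ventures.PercRepro.ProfilePointedCircuitClassesStarNine

/-!
# PercRepro — THE SHARP (★) ALONG A SERIES PAIR: (★) ON `N` SPLITS EXACTLY INTO ITS PART AVOIDING `b'` AND (★) ONE
LEVEL DOWN ON `N ／ b ∖ b'`; THE TWO-SERIES-PAIR REGIME OF THE TWELVE-POINT STATEMENT IN GENERAL POSITION
(p5, gen 52; `proofs/P5-GM1.md` §79)

Let `{b, b'}` be a series pair of `N` with `#E = ρ(E) + (k + 1)`, and `e ≠ f` two points outside it.  The bi-independent
`(k + 1)`-sets through `b'` avoid `b` (`not_mem_of_mem_biIndepSets_of_seriesPair`), the swap `W ↦ W − b' + b` takes them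
to the sets through `b` avoiding `b'` (`card_filter_swap_of_seriesPair`), and those are the lifts `Y + b` of the
bi-independent `k`-sets of the minor `N ／ b ∖ b'` (`card_filter_minor_insert_left_eq_of_seriesPair`).  Hence, for every
`S ⊆ E − b − b'`, **`thru_{k+1}(S + b') = thru_k^{N ／ b ∖ b'}(S)`** (`thruCount_insert_eq_thruCount_minor_of_seriesPair`),
and the (★)-defect `in(e) − in(f) − thru({e, f})` of `N` is EXACTLY the sum of
* its part over the sets AVOIDING `b'` — the **SHARP** statement `Sharp(N, b'; e, f)`:
  `in(e) + thru({b', f}) + thru({b', e, f}) ≤ in(f) + thru({e, f}) + thru({b', e})`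
  (i.e. `#{W : b' ∉ W, e ∈ W ∌ f} ≤ #{W : b' ∉ W, f ∈ W}`), and
* (★) at `(e, f)` one level down on `N ／ b ∖ b'`.

So **(★) on `N` follows from `Sharp(N, b')` and (★) on the minor** (`star_of_sharp_of_star_minor`, every `k`).  At
`(11, 6)` the Sharp statement is the Prop **`StarElevenSharp`** (a CONJECTURE def, NOT asserted: 0 violations on
567,696 random ordered pairs over GF(3, 5, 7) including coloop families, tight in 2–10 % of them, §79); at `(9, 5)` it is
exhaustively true on the engine's complete catalogue of eight-element matroids (all 940 rank-`4` matroids × 8 marks: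
279,552 ordered pairs, 0 violations, 34,335 tight).  CONSEQUENCE: **the two-series-pair regime of the twelve-point
statement IN GENERAL POSITION** — no common `4`-circuit needed (§77 needed `ρ{a, a', b, b'} = 3`) — follows from (★)₉ on
`N ／ {a, b} ∖ b'` and `Sharp` on `N ／ a` at the pair `{b, b'}` (`inCount_five_le_outCount_six_of_two_seriesPairs_of_sharp_of_star`,
and `…_of_starNine_of_starElevenSharp` under the two Props).  This covers the 140 two-pair hits of the residual
climb j327459 (every one of them has `A' ≤ 0`, `B' ≤ 0`, `A' + B' ≤ −6`, §79).
-/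

open scoped Matroid

namespace PercRepro.Cogirth

open Finset ThmH Skew Shadow Profile

variable {α : Type} [DecidableEq α] {N : Matroid α} [N.Finite]

section StarSharp

/-- **THE SHARP (★) AT `(11, 6)` ALONG A SERIES PAIR** (a CONJECTURE `Prop`, NOT asserted): on every matroid with
`#E = 11`, `ρ(E) = 6`, a series pair `{b, b'}` and two further distinct points `e, f` outside it, neither a coloop,
`in_5(e) + thru_5({b', f}) + thru_5({b', e, f}) ≤ in_5(f) + thru_5({e, f}) + thru_5({b', e})` — the part of (★) at
`(e, f)` carried by the bi-independent `5`-sets avoiding `b'`.  Random-clean (§79); the `(9, 5)` sibling is exhaustively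
true on the complete eight-element catalogue. -/
def StarElevenSharp (α : Type) [DecidableEq α] : Prop :=
  ∀ (N : Matroid α) [N.Finite], (gr N).card = 11 → rk N (gr N) = 6 →
    ∀ b b' e f : α, SeriesPair N b b' → e ∈ gr N → f ∈ gr N → e ≠ f → e ≠ b → e ≠ b' → f ≠ b → f ≠ b' →
      rk N ((gr N).erase e) = 6 → rk N ((gr N).erase f) = 6 →
      inCount N 5 e + thruCount N 5 {b', f} + thruCount N 5 {b', e, f} ≤
        inCount N 5 f + thruCount N 5 {e, f} + thruCount N 5 {b', e}

/-- `S ⊆ W − x + y ↔ S ⊆ W` when `x, y ∉ S`. -/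
theorem subset_insert_erase_iff_of_notMem {S W : Finset α} {x y : α} (hxS : x ∉ S) (hyS : y ∉ S) :
    S ⊆ insert y (W.erase x) ↔ S ⊆ W := by
  constructor
  · intro hS z hz
    have hz' := hS hz
    rw [mem_insert, mem_erase] at hz'
    rcases hz' with hzy | hzW
    · exact absurd (hzy ▸ hz) hyS
    · exact hzW.2
  · intro hS z hz
    exact mem_insert_of_mem (mem_erase.2 ⟨fun hzx => hxS (hzx ▸ hz), hS hz⟩)

/-- `S ⊆ Y + x ↔ S ⊆ Y` when `x ∉ S`. -/
theorem subset_insert_iff_of_notMem {S Y : Finset α} {x : α} (hxS : x ∉ S) :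
    S ⊆ insert x Y ↔ S ⊆ Y := by
  constructor
  · intro hS z hz
    have hz' := hS hz
    rw [mem_insert] at hz'
    rcases hz' with hzx | hzY
    · exact absurd (hzx ▸ hz) hxS
    · exact hzY
  · intro hS
    exact hS.trans (subset_insert _ _)

/-- **THE SETS THROUGH `b'` ARE THE BI-INDEPENDENT SETS OF THE MINOR ONE LEVEL DOWN**: for a series pair `{b, b'}` of
`N` with `#E = ρ(E) + (k + 1)` and `S ⊆ E − b − b'`, `thru_{k+1}(S + b') = thru_k^{N ／ b ∖ b'}(S)`: a bi-independent
`(k+1)`-set through `b'` avoids `b`, the swap `W ↦ W − b' + b` is a bijection onto the sets through `b` avoiding `b'`,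
and those are the lifts `Y + b` of the bi-independent `k`-sets `Y` of the minor. -/
theorem thruCount_insert_eq_thruCount_minor_of_seriesPair {b b' : α} (h : SeriesPair N b b') {k : ℕ}
    (hn : (gr N).card = rk N (gr N) + (k + 1)) {S : Finset α} (hbS : b ∉ S) (hb'S : b' ∉ S) :
    thruCount N (k + 1) (insert b' S) = thruCount ((N ／ ({b} : Set α)) ＼ ({b'} : Set α)) k S := by
  -- the sets through `b'` avoid `b`
  have h1 : thruCount N (k + 1) (insert b' S) =
      ((biIndepSets N (k + 1)).filter (fun W => (S ⊆ W ∧ b ∉ W) ∧ b' ∈ W)).card := by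
    unfold thruCount
    apply congrArg
    apply filter_congr
    intro W hW
    rw [insert_subset_iff]
    constructor
    · rintro ⟨hb'W, hSW⟩
      exact ⟨⟨hSW, not_mem_of_mem_biIndepSets_of_seriesPair h.symm hn hW hb'W⟩, hb'W⟩
    · rintro ⟨⟨hSW, _⟩, hb'W⟩
      exact ⟨hb'W, hSW⟩
  -- the swap `b ↔ b'`
  have h2 := card_filter_swap_of_seriesPair h (k + 1) (fun W => S ⊆ W)
    (fun W => subset_insert_erase_iff_of_notMem hbS hb'S)
    (fun W => subset_insert_erase_iff_of_notMem hb'S hbS)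
  -- the transfer to the minor
  have h3 := card_filter_minor_insert_left_eq_of_seriesPair h k (fun Y => S ⊆ Y)
    (fun Y => subset_insert_iff_of_notMem hbS)
  rw [h1, ← h2, ← h3]
  rfl

/-- **(★) ON `N` FROM `Sharp(N, b')` AND (★) ONE LEVEL DOWN ON `N ／ b ∖ b'`**: for a series pair `{b, b'}` with
`#E = ρ(E) + (k + 1)` and `e ≠ f` outside the pair, the (★)-defect `in_{k+1}(e) − in_{k+1}(f) − thru_{k+1}({e, f})`
is the defect over the sets avoiding `b'` (the Sharp hypothesis) plus the defect over the sets through `b'`, which is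
the (★)-defect of the minor at level `k` by `thruCount_insert_eq_thruCount_minor_of_seriesPair`. -/
theorem star_of_sharp_of_star_minor {b b' e f : α} (h : SeriesPair N b b') {k : ℕ}
    (hn : (gr N).card = rk N (gr N) + (k + 1)) (heb : e ≠ b) (heb' : e ≠ b') (hfb : f ≠ b) (hfb' : f ≠ b')
    (hsharp : inCount N (k + 1) e + thruCount N (k + 1) {b', f} + thruCount N (k + 1) {b', e, f} ≤
      inCount N (k + 1) f + thruCount N (k + 1) {e, f} + thruCount N (k + 1) {b', e})
    (hminor : inCount ((N ／ ({b} : Set α)) ＼ ({b'} : Set α)) k e ≤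
      inCount ((N ／ ({b} : Set α)) ＼ ({b'} : Set α)) k f +
        thruCount ((N ／ ({b} : Set α)) ＼ ({b'} : Set α)) k {e, f}) :
    inCount N (k + 1) e ≤ inCount N (k + 1) f + thruCount N (k + 1) {e, f} := by
  have hbe : b ∉ ({e} : Finset α) := by rw [mem_singleton]; exact fun h' => heb h'.symm
  have hb'e : b' ∉ ({e} : Finset α) := by rw [mem_singleton]; exact fun h' => heb' h'.symm
  have hbf : b ∉ ({f} : Finset α) := by rw [mem_singleton]; exact fun h' => hfb h'.symm
  have hb'f : b' ∉ ({f} : Finset α) := by rw [mem_singleton]; exact fun h' => hfb' h'.symm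
  have hbef : b ∉ ({e, f} : Finset α) := by
    rw [mem_insert, mem_singleton]
    rintro (h' | h')
    · exact heb h'.symm
    · exact hfb h'.symm
  have hb'ef : b' ∉ ({e, f} : Finset α) := by
    rw [mem_insert, mem_singleton]
    rintro (h' | h')
    · exact heb' h'.symm
    · exact hfb' h'.symm
  have he' := thruCount_insert_eq_thruCount_minor_of_seriesPair h hn hbe hb'e
  have hf' := thruCount_insert_eq_thruCount_minor_of_seriesPair h hn hbf hb'f
  have hef' := thruCount_insert_eq_thruCount_minor_of_seriesPair h hn hbef hb'ef
  rw [thruCount_singleton] at he' hf'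
  omega

/-- **THE TWO-SERIES-PAIR REGIME IN GENERAL POSITION, FROM `Sharp` ON `N ／ a` AND (★)₉ ON `N ／ {a, b} ∖ b'`**: on
`#E = 12`, `ρ(E) = 7`, with two disjoint series pairs `{a, a'}`, `{b, b'}` and `e` outside them (no condition on
`ρ{a, a', b, b'}`), if the Sharp statement holds on `N ／ a` at the pair `{b, b'}` and the points `(e, a')`, and (★)₉
holds at `(e, a')` on `N ／ {a, b} ∖ b'`, then `in_5(e) ≤ out_6(e)`: (★) at `(e, a')` on `N ／ a` follows from the two by
`star_of_sharp_of_star_minor`, and §66's `inCount_five_le_outCount_six_of_seriesPair_of_star` closes. -/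
theorem inCount_five_le_outCount_six_of_two_seriesPairs_of_sharp_of_star (hn : (gr N).card = 12)
    (hR : rk N (gr N) = 7) {a a' b b' e : α} (h : SeriesPair N a a') (h' : SeriesPair N b b') (hab : a ≠ b)
    (hab' : a ≠ b') (ha'b : a' ≠ b) (ha'b' : a' ≠ b') (he : e ∈ gr N) (hea : e ≠ a) (hea' : e ≠ a')
    (heb : e ≠ b) (heb' : e ≠ b')
    (hsharp : inCount (N ／ ({a} : Set α)) 5 e + thruCount (N ／ ({a} : Set α)) 5 {b', a'} +
        thruCount (N ／ ({a} : Set α)) 5 {b', e, a'} ≤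
      inCount (N ／ ({a} : Set α)) 5 a' + thruCount (N ／ ({a} : Set α)) 5 {e, a'} +
        thruCount (N ／ ({a} : Set α)) 5 {b', e})
    (h9 : inCount (((N ／ ({a} : Set α)) ／ ({b} : Set α)) ＼ ({b'} : Set α)) 4 e ≤
      inCount (((N ／ ({a} : Set α)) ／ ({b} : Set α)) ＼ ({b'} : Set α)) 4 a' +
        thruCount (((N ／ ({a} : Set α)) ／ ({b} : Set α)) ＼ ({b'} : Set α)) 4 {e, a'}) :
    inCount N 5 e ≤ outCount N 6 e := by
  have ha : a ∈ gr N := h.1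
  have hind := indep_singleton_of_seriesPair h
  have hgr : gr (N ／ ({a} : Set α)) = (gr N).erase a := gr_contract'
  have hn' : (gr (N ／ ({a} : Set α))).card = 11 := by
    rw [hgr, card_erase_of_mem ha, hn]
  have hR' : rk (N ／ ({a} : Set α)) (gr (N ／ ({a} : Set α))) = 6 := by
    have := rk_gr_contract_add_one hind ha
    omega
  have hser' : SeriesPair (N ／ ({a} : Set α)) b b' := seriesPair_contract_of_ne h' ha hab hab' hind
  have hn5 : (gr (N ／ ({a} : Set α))).card = rk (N ／ ({a} : Set α)) (gr (N ／ ({a} : Set α))) + (4 + 1) := by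
    omega
  have hstar := star_of_sharp_of_star_minor (k := 4) hser' hn5 heb heb' ha'b ha'b' hsharp h9
  exact inCount_five_le_outCount_six_of_seriesPair_of_star hn hR h he hea hea' hstar

/-- **THE TWO-SERIES-PAIR REGIME IN GENERAL POSITION UNDER `StarNine` AND `StarElevenSharp`**: the two instance
hypotheses of `inCount_five_le_outCount_six_of_two_seriesPairs_of_sharp_of_star` discharged from the Props, given that
`e` is not a coloop of `N` and that the nine-point minor `N ／ {a, b} ∖ b'` is coloop-free (`a'` is never a coloop of
`N ／ a`, by the series pair). -/
theorem inCount_five_le_outCount_six_of_two_seriesPairs_of_starNine_of_starElevenSharp (hS : StarNine α)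
    (hSh : StarElevenSharp α) (hn : (gr N).card = 12) (hR : rk N (gr N) = 7) {a a' b b' e : α}
    (h : SeriesPair N a a') (h' : SeriesPair N b b') (hab : a ≠ b) (hab' : a ≠ b') (ha'b : a' ≠ b)
    (ha'b' : a' ≠ b') (he : e ∈ gr N) (hea : e ≠ a) (hea' : e ≠ a') (heb : e ≠ b) (heb' : e ≠ b')
    (hce : rk N ((gr N).erase e) = 7)
    (hcf9 : ∀ z ∈ gr (((N ／ ({a} : Set α)) ／ ({b} : Set α)) ＼ ({b'} : Set α)),
      rk (((N ／ ({a} : Set α)) ／ ({b} : Set α)) ＼ ({b'} : Set α))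
        ((gr (((N ／ ({a} : Set α)) ／ ({b} : Set α)) ＼ ({b'} : Set α))).erase z) = 5) :
    inCount N 5 e ≤ outCount N 6 e := by
  have ha : a ∈ gr N := h.1
  have ha' : a' ∈ gr N := h.2.1
  have haa' : a ≠ a' := h.2.2.1
  have hind := indep_singleton_of_seriesPair h
  have hgr : gr (N ／ ({a} : Set α)) = (gr N).erase a := gr_contract'
  have hn' : (gr (N ／ ({a} : Set α))).card = 11 := by
    rw [hgr, card_erase_of_mem ha, hn]
  have hE := rk_gr_contract_add_one hind ha
  have hR' : rk (N ／ ({a} : Set α)) (gr (N ／ ({a} : Set α))) = 6 := by omega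
  have hser' : SeriesPair (N ／ ({a} : Set α)) b b' := seriesPair_contract_of_ne h' ha hab hab' hind
  have he' : e ∈ gr (N ／ ({a} : Set α)) := by rw [hgr]; exact mem_erase.2 ⟨hea, he⟩
  have ha'' : a' ∈ gr (N ／ ({a} : Set α)) := by rw [hgr]; exact mem_erase.2 ⟨haa'.symm, ha'⟩
  -- `e` and `a'` are not coloops of `N ／ a`
  have hce' : rk (N ／ ({a} : Set α)) ((gr (N ／ ({a} : Set α))).erase e) = 6 := by
    have h1 := rk_contract_add_one hind (X := ((gr N).erase a).erase e) (erase_subset _ _)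
    have e1 : insert a (((gr N).erase a).erase e) = (gr N).erase e := by
      rw [erase_right_comm, insert_erase (mem_erase.2 ⟨hea.symm, ha⟩)]
    rw [e1, hce] at h1
    rw [hgr]
    omega
  have hca' : rk (N ／ ({a} : Set α)) ((gr (N ／ ({a} : Set α))).erase a') = 6 := by
    have h1 := rk_contract_add_one hind (X := ((gr N).erase a).erase a') (erase_subset _ _)
    have e1 : insert a (((gr N).erase a).erase a') = (gr N).erase a' := by
      rw [erase_right_comm, insert_erase (mem_erase.2 ⟨haa', ha⟩)]
    rw [e1, h.2.2.2.2.1, hR] at h1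
    rw [hgr]
    omega
  have hsharp := hSh (N ／ ({a} : Set α)) hn' hR' b b' e a' hser' he' ha'' hea' heb heb' ha'b ha'b' hce' hca'
  -- (★)₉ on the nine-point minor
  have hn9 := card_gr_minor_add_two_of_seriesPair hser'
  have hR9 := rk_gr_minor_add_one_of_seriesPair hser'
  have hgr9 := gr_minor_of_seriesPair (N := N ／ ({a} : Set α)) b b'
  have he9 : e ∈ gr (((N ／ ({a} : Set α)) ／ ({b} : Set α)) ＼ ({b'} : Set α)) := by
    rw [hgr9, hgr]
    exact mem_erase.2 ⟨heb', mem_erase.2 ⟨heb, mem_erase.2 ⟨hea, he⟩⟩⟩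
  have ha9 : a' ∈ gr (((N ／ ({a} : Set α)) ／ ({b} : Set α)) ＼ ({b'} : Set α)) := by
    rw [hgr9, hgr]
    exact mem_erase.2 ⟨ha'b', mem_erase.2 ⟨ha'b, mem_erase.2 ⟨haa'.symm, ha'⟩⟩⟩
  have h9 := hS (((N ／ ({a} : Set α)) ／ ({b} : Set α)) ＼ ({b'} : Set α)) (by omega) (by omega) hcf9 e he9 a' ha9
    hea'
  exact inCount_five_le_outCount_six_of_two_seriesPairs_of_sharp_of_star hn hR h h' hab hab' ha'b ha'b' he hea
    hea' heb heb' hsharp h9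

end StarSharp

end PercRepro.Cogirth
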